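import Summits.BirchSwinnertonDyer.BirchSwinnertonDyer.Theorems.GenusKolyvaginAtTwoMazurRubinCor34iiDictionary
import HarnessLib

/-!
# Route `GenusKolyvaginAtTwo`, crux #2 `GenusPrimitiveSupplyAtTwo` (stmt-BirchSwinnertonDyer-22136):
# MAZUR–RUBIN 2010 COR. 3.4 (ii) OVER `ℚ` IS A TREE THEOREM — discharge of the named fact `MazurRubin2010.cor34ii_rat`
# (`T = ∅`: `#Sel₂(E^F/ℚ) = #Sel₂(E/ℚ)` under the splitting list of Prop. 3.3)

Lead seat `bsd-line-gk2-p1` g9 (cell `bsd-f1-sign2`). THEOREMS ONLY (no definition, no named fact, no `sorry`); helper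
`--supports stmt-BirchSwinnertonDyer-22136`; no item of this route is closed by it; BSD is not proved by any of this.

WHAT. `Literature.NumberTheory.EllipticCurves.MazurRubin2010.cor34ii_rat` (Mazur–Rubin, Invent. Math. 181 (2010), Cor. 3.4 (ii)
with the hypotheses of Prop. 3.3, `K = ℚ`): for an elliptic `E/ℚ` (any model `W`), a square-free `d ≠ 1`, `F = ℚ(√d)`: if every
additive prime splits in `F`, every multiplicative prime with `ord_p Δ` even splits, `2` splits, the real place splits when
`Δ > 0`, every multiplicative prime with `ord_p Δ` odd is unramified, and `E(ℚ_p)[2] = 0` at every ramified prime (`T = ∅`), then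
`#Sel₂(E^{(d)}) = #Sel₂(E)` for every model of the twist. It was a cite-only named fact with 42 consumer files (cells `u2`,
`bsd-f1-sign2`); this file PROVES it (`MazurRubin2010.cor34ii_rat_holds`).

HOW (no duality; Lemma 2.10 place by place, as printed: «By Lemma 2.10, `H¹_f(K_v,E[2]) = H¹_f(K_v,E^F[2])` if `v ∉ T`.
Therefore `S_T ⊂ Sel₂(E^F/K) ⊂ S^T`», `T = ∅`). The engine is the sibling file `…TwistTamagawaOdd`
(`natCard_selmerGroup_twist_eq_of_menu`: the four-row finite menu SPLIT / TAMAGAWA-ODD / BOTH GOOD / SILENT and the two-row infinite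
menu SPLIT / `H¹ = 0`, over every number field, unconditionally). The sibling file `…MazurRubinCor34iiDictionary` supplies the
`ℚ`-dictionary from the printed hypotheses to the menu, for the pair `(W, W^{(d)})`:
* §A–§B `natCard_torsionBy_two_quadraticTwist`, `natCard_twoTorsion_padic_twist_eq` — the `2`-torsion of a quadratic twist over
  ANY field of characteristic `≠ 2` has the cardinality of that of the curve (the roots of the `2`-division cubics correspond under
  `x ↦ d x`); hence `E^{(d)}(ℚ_p)[2] = 0 ⟺ E(ℚ_p)[2] = 0` (the SILENT row at the ramified primes, which are good and odd here).
* §C `exists_sq_eq_adicCompletion_of_ncard_primesOver_eq_two` — a prime that splits in `ℚ(√d)` has `d ∈ (ℚ_v^×)²`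
  (`d_F ∈ {d, 4d}` by `Quadratic.discr_eq_of_sq_eq_intCast` / `…four_mul…`; `d_F` is a `p`-adic square at a split prime by
  `Castella2018.TamagawaQuadratic.isSquare_padic_discr_of_splitsIn`; transport along `ℚ_v ≃ ℚ_p`) — the SPLIT row
  (additive primes, multiplicative primes with even `ord_p Δ`, the prime `2`); `pos_of_isTotallyReal_of_sq_eq` — `F` real ⟹ `d > 0`.
* §D `not_two_dvd_localTamagawaNumber_of_mult_of_odd` — `c_v` is odd at a multiplicative place with `ord_v Δ_min` odd (split:
  `c_v = ord_v Δ_min`; non-split: `c_v = 1`), any number field; §E `odd_ordMinimalDiscriminant_iff_odd_padicValRat` — `ord_v Δ_min ≡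
  ord_p Δ(W) (mod 12)` at the places of `𝓞 ℚ` (any model); §F the twist at an odd `p ∤ d`: good stays good, multiplicative stays
  multiplicative (`AdditivePotMult` on a global minimal model, transported by `quadraticTwist_smul`), `ord_p Δ(W^{(d)}) = 6 ord_p d +
  ord_p Δ(W)` — the TAMAGAWA row at the multiplicative primes with odd `ord_p Δ` (Lemma 2.10 (iii) = Lemma 2.9) and the BOTH-GOOD row
  (Lemma 2.10 (v), `p` odd).
* THIS FILE `MazurRubin2010.cor34ii_rat_holds` — assembly; the real place: `Δ < 0` ⟹ `H¹(ℝ, ·) = 0` for both (`ArchVanishing`), `Δ > 0` ⟹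
  `F` real ⟹ `d > 0` ⟹ split; the given model `W'` of the twist by `natCard_selmerGroup_smul`.

NOT done here (honest limits): the place-wise sibling `MazurRubin2010.d2_eq_of_lemma210_rat` is NOT discharged — its row (v) admits
`p = 2` good and INERT in `F`, where Lemma 2.10 (v) needs the flat-cohomology description of `H¹_f(ℚ₂, E[2])`, absent from the tree;
`prop33_rat` / `cor34i_singleton_rat` (the `T ≠ ∅` laws) need Kramer's parity (gk2-p5's lane). BSD is not proved by any of this.

References: [MazurRubin2010] arXiv:0904.3709 = Invent. Math. 181 (2010): Lemma 2.2 (i), Lemma 2.9, Lemma 2.10, Prop. 3.3, Cor. 3.4 (ii)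
(DASH copy p0008–p0010); [SilvermanAEC2009] VII.1, VII.5 Prop. 5.1, X.5 Cor. 5.4, III.2.3; [SilvermanATAEC1994] IV.9.4 (Tate's
algorithm, `c_v`); [Marcus2018] Ch. 2 Thm. 1 (`d_F`); [NeukirchANT1999] I (8.5) (decomposition law in quadratic fields).
-/

set_option linter.dupNamespace false -- tree convention: `Summit.BirchSwinnertonDyer.BirchSwinnertonDyer.Theorems` (summit = sub-problem)
set_option autoImplicit false

noncomputable section

open scoped Classical ContRepresentation

namespace Summit.BirchSwinnertonDyer.BirchSwinnertonDyer.Theorems.GenusKolyTwistTamagawa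

open WeierstrassCurve Field NumberField IsDedekindDomain Function Polynomial
open Literature.NumberTheory.EllipticCurves Literature.NumberTheory.GaloisRepresentations
open Literature.NumberTheory.GaloisCohomology
open Rat.HeightOneSpectrum

/-! ## §G Mazur–Rubin Cor. 3.4 (ii) over `ℚ` HOLDS -/

section Main

open Literature.NumberTheory.QuadraticFields
open Summit.BirchSwinnertonDyer.BirchSwinnertonDyer.Theorems.GenusKolyTwistingPrime (primesEquiv_eq natCast_not_mem_of_not_dvd)

/-- **MAZUR–RUBIN 2010 COR. 3.4 (ii) OVER `ℚ` HOLDS** — DISCHARGE of the named fact `MazurRubin2010.cor34ii_rat`: for an elliptic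
`E/ℚ` (any model `W`), `d` square-free `≠ 1`, `F = ℚ(√d)` with the splitting list of Prop. 3.3 (additive primes, multiplicative
primes with even `ord_p Δ`, the prime `2`, and — if `Δ > 0` — the real place SPLIT; multiplicative primes with odd `ord_p Δ`
UNRAMIFIED) and `T = ∅` (`E(ℚ_p)[2] = 0` at every ramified prime): `#Sel₂(W') = #Sel₂(W)` for every model `W'` of `E^{(d)}`.
Proof: Lemma 2.10 at every place — SPLIT row at the primes of the splitting list and at `2` (§C), TAMAGAWA-ODD row (Lemma 2.9 /
2.10 (iii)) at the multiplicative primes with odd `ord_p Δ` (§D–§F), BOTH-GOOD row (2.10 (v)) at the odd unramified good primes,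
SILENT row (the `T = ∅` clause, 2.10 (ii)) at the ramified primes (§B, §F), real place (2.10 (i)/(iv)); then the sibling file's
unconditional `T = ∅` law `natCard_selmerGroup_twist_eq_of_menu` and model invariance `natCard_selmerGroup_smul`. No duality input.
[cite: MazurRubin2010, Cor. 3.4 (ii) with Prop. 3.3 and Lemma 2.10 (DASH copy p0008 L26–L34, p0009 L63–L83, p0010 L51–L58)]
[cite: SilvermanAEC2009, VII.5 Prop. 5.1, X.5 Cor. 5.4] [cite: SilvermanATAEC1994, IV.9.4] -/
theorem _root_.Literature.NumberTheory.EllipticCurves.MazurRubin2010.cor34ii_rat_holds :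
    MazurRubin2010.cor34ii_rat := by
  intro W _ d hsf hd1 F _ _ h2 hx h1 h2' h3 h4 h5 hT W' _ hW'
  classical
  have hd0 : d ≠ 0 := fun h ↦ by subst h; exact not_squarefree_zero hsf
  have hdQ : (d : ℚ) ≠ 0 := by exact_mod_cast hd0
  obtain ⟨x, hx⟩ := hx
  haveI hEt := W.isElliptic_quadraticTwist hdQ
  -- `2` splits in `F`, so `d_F ≡ 1 (mod 8)` and `d_F = d`
  have h8 : NumberField.discr F % 8 = 1 := (Quadratic.ncard_primesOver_two_eq_two_iff h2).mp h3
  have hdiscd : NumberField.discr F = d := by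
    rcases discr_eq_or_eq_four_mul h2 hx hsf hd1 with h | h
    · exact h
    · exfalso; omega
  -- the finite place menu for the pair `(W, W^{(d)})`
  have hfin : ∀ v : HeightOneSpectrum (𝓞 ℚ),
      (∃ s : v.adicCompletion ℚ, s ^ 2 = algebraMap ℚ (v.adicCompletion ℚ) (d : ℚ)) ∨
      (((2 : ℕ) : 𝓞 ℚ) ∉ v.asIdeal ∧
        ¬ 2 ∣ (W.baseChange (v.adicCompletion ℚ)).localTamagawaNumber (v.adicCompletionIntegers ℚ) ∧
        ¬ 2 ∣ ((W.quadraticTwist (d : ℚ)).baseChange (v.adicCompletion ℚ)).localTamagawaNumber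
          (v.adicCompletionIntegers ℚ)) ∨
      (((2 : ℕ) : 𝓞 ℚ) ∉ v.asIdeal ∧ W.HasGoodReductionAt v ∧ (W.quadraticTwist (d : ℚ)).HasGoodReductionAt v) ∨
      (((2 : ℕ) : 𝓞 ℚ) ∉ v.asIdeal ∧
        Nat.card (nsmulAddMonoidHom 2 : (W.baseChange (v.adicCompletion ℚ)).toAffine.Point →+ _).ker = 1 ∧
        Nat.card (nsmulAddMonoidHom 2 :
          ((W.quadraticTwist (d : ℚ)).baseChange (v.adicCompletion ℚ)).toAffine.Point →+ _).ker = 1) := by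
    intro v
    haveI hF : Fact ((primesEquiv v : Nat.Primes) : ℕ).Prime := ⟨(primesEquiv v).2⟩
    by_cases hsplit : ((Ideal.span {(((primesEquiv v : Nat.Primes) : ℕ) : ℤ)}).primesOver (𝓞 F)).ncard = 2
    · exact Or.inl (exists_sq_eq_adicCompletion_of_ncard_primesOver_eq_two h2 hx hsf hd1 v hsplit)
    · -- `v` does not split: in particular `v ∤ 2`
      have hp2 : ((primesEquiv v : Nat.Primes) : ℕ) ≠ 2 := by
        intro hp2
        apply hsplit
        rw [hp2]
        exact h3
      have h2v : ((2 : ℕ) : 𝓞 ℚ) ∉ v.asIdeal := fun h ↦ hp2 (primesEquiv_eq Nat.prime_two h)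
      rcases W.hasGoodReductionAt_or_hasMultiplicativeReductionAt_or_hasAdditiveReductionAt v with
        hgood | hmult | hadd
      · by_cases hpd : (((primesEquiv v : Nat.Primes) : ℕ) : ℤ) ∣ d
        · -- ramified prime of good reduction: SILENT row (`T = ∅` hypothesis)
          have hpdisc : (((primesEquiv v : Nat.Primes) : ℕ) : ℤ) ∣ NumberField.discr F := hdiscd ▸ hpd
          have hW2 := hT ((primesEquiv v : Nat.Primes) : ℕ) hpdisc
          refine Or.inr (Or.inr (Or.inr ⟨h2v, natCard_ker_nsmul_two_adicCompletion_eq_one_of_forall W v hW2, ?_⟩))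
          refine natCard_ker_nsmul_two_adicCompletion_eq_one_of_forall (W.quadraticTwist (d : ℚ)) v ?_
          have hc : Nat.card {Q : ((W.quadraticTwist (d : ℚ)).baseChange
              ℚ_[((primesEquiv v : Nat.Primes) : ℕ)]).toAffine.Point // 2 • Q = 0} = 1 := by
            rw [natCard_twoTorsion_padic_twist_eq W hdQ (Wd := W.quadraticTwist (d : ℚ)) (C := 1) (one_smul _ _)]
            haveI : Unique {Q : (W.baseChange ℚ_[((primesEquiv v : Nat.Primes) : ℕ)]).toAffine.Point // 2 • Q = 0} :=
              { default := ⟨0, by simp⟩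
                uniq := fun Q ↦ Subtype.ext (hW2 Q.1 Q.2) }
            exact Nat.card_unique
          intro Q hQ
          haveI : Finite {Q : ((W.quadraticTwist (d : ℚ)).baseChange
              ℚ_[((primesEquiv v : Nat.Primes) : ℕ)]).toAffine.Point // 2 • Q = 0} :=
            Nat.finite_of_card_ne_zero (by rw [hc]; norm_num)
          exact congrArg Subtype.val ((Nat.card_eq_one_iff_unique.mp hc).1.elim ⟨Q, hQ⟩ ⟨0, by simp⟩)
        · -- unramified prime of good reduction: BOTH GOOD
          exact Or.inr (Or.inr (Or.inl
            ⟨h2v, hgood, hasGoodReductionAt_quadraticTwist_of_not_dvd_any W v hp2 hpd hgood⟩))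
      · -- multiplicative prime: `ord Δ` even would split, so it is odd and unramified: TAMAGAWA row
        have hmultp : W.HasMultiplicativeReductionAtPrime ((primesEquiv v : Nat.Primes) : ℕ) :=
          (hasMultiplicativeReductionAtPrime_iff_hasMultiplicativeReductionAt_ringOfIntegers W v).mpr hmult
        rcases Int.even_or_odd (padicValRat ((primesEquiv v : Nat.Primes) : ℕ) W.Δ) with hev | hodd
        · exact absurd (h2' _ hmultp hev) hsplit
        · have hpdisc := h5 _ hmultp hodd
          have hpd : ¬ (((primesEquiv v : Nat.Primes) : ℕ) : ℤ) ∣ d := hdiscd ▸ hpdisc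
          refine Or.inr (Or.inl ⟨h2v, ?_, ?_⟩)
          · exact not_two_dvd_localTamagawaNumber_of_mult_of_odd W v hmult
              ((odd_ordMinimalDiscriminant_iff_odd_padicValRat W v).mpr hodd)
          · exact not_two_dvd_localTamagawaNumber_of_mult_of_odd (W.quadraticTwist (d : ℚ)) v
              (hasMultiplicativeReductionAt_quadraticTwist_of_not_dvd_any W v hp2 hpd hmult)
              ((odd_ordMinimalDiscriminant_iff_odd_padicValRat _ v).mpr
                ((odd_padicValRat_Δ_quadraticTwist_iff W hpd).mpr hodd))
      · -- additive prime: it splits by hypothesis — contradiction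
        have hng : ¬ W.HasGoodReductionAtPrime ((primesEquiv v : Nat.Primes) : ℕ) := fun h ↦
          hadd.not_hasGoodReductionAt ((hasGoodReductionAtPrime_iff_hasGoodReductionAt_ringOfIntegers v W).mp h)
        have hnm : ¬ W.HasMultiplicativeReductionAtPrime ((primesEquiv v : Nat.Primes) : ℕ) := fun h ↦
          hadd.not_hasMultiplicativeReductionAt
            ((hasMultiplicativeReductionAtPrime_iff_hasMultiplicativeReductionAt_ringOfIntegers W v).mp h)
        exact absurd (h1 _ hng hnm) hsplit
  -- the infinite place menu
  have hinf : ∀ w : InfinitePlace ℚ,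
      (∃ s : w.Completion, s ^ 2 = algebraMap ℚ w.Completion (d : ℚ)) ∨
      ((∀ y : galoisCohomology (W.localGaloisModule w.Completion) 1, y = 0) ∧
        (∀ y : galoisCohomology ((W.quadraticTwist (d : ℚ)).localGaloisModule w.Completion) 1, y = 0)) := by
    intro w
    rcases lt_or_gt_of_ne W.isUnit_Δ.ne_zero with hneg | hpos
    · right
      have hneg' : (W.quadraticTwist (d : ℚ)).Δ < 0 := by
        rw [quadraticTwist_Δ]
        exact mul_neg_of_pos_of_neg (by positivity) hneg
      exact ⟨fun y ↦ GenusExact.ArchVanishing.localH1_infinitePlace_eq_zero_of_Δ_neg W w hneg y,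
        fun y ↦ GenusExact.ArchVanishing.localH1_infinitePlace_eq_zero_of_Δ_neg _ w hneg' y⟩
    · left
      haveI := h4 hpos
      have hdpos : 0 < d := pos_of_isTotallyReal_of_sq_eq hx hd0
      obtain ⟨m, hm⟩ : ∃ m : ℕ, (m : ℤ) = d := ⟨d.natAbs, Int.natAbs_of_nonneg hdpos.le⟩
      obtain ⟨s, hs⟩ := GenusKolyLowering.exists_sq_eq_infinitePlace_completion w m
      refine ⟨s, ?_⟩
      rw [hs, ← hm, Int.cast_natCast]
  -- the `T = ∅` law for the twist `W^{(d)}` itself, then transport to the given model `W'`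
  have key := natCard_selmerGroup_twist_eq_of_menu W hdQ (Wd := W.quadraticTwist (d : ℚ)) (C := 1)
    (one_smul _ _) hfin hinf
  obtain ⟨C, hC⟩ := hW'
  have hsm := natCard_selmerGroup_smul W' C two_ne_zero
  rw [hC] at hsm
  rw [Nat.cast_ofNat] at key hsm
  rw [← hsm, key]

end Main

end Summit.BirchSwinnertonDyer.BirchSwinnertonDyer.Theorems.GenusKolyTwistTamagawa

end
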